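import Mathlib
import Summits.Ventures.PercRepro2.Defs
import Summits.Ventures.PercRepro2.Independence
import Summits.Ventures.PercRepro2.Graph
import Summits.Ventures.PercRepro2.Exploration
import Summits.Ventures.PercRepro2.Induced
import Summits.Ventures.PercRepro2.R2PrimeThreeReduction
import Summits.Ventures.PercRepro2.YBridge
import Summits.Ventures.PercRepro2.HCov
import Summits.Ventures.PercRepro2.HCovFns
import Summits.Ventures.PercRepro2.HCovCubic
import Summits.Ventures.PercRepro2.TriDisagreement
import Summits.Ventures.PercRepro2.TriDisagreementPinned
import Summits.Ventures.PercRepro2.HubModel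
import Summits.Ventures.PercRepro2.HubLaw
import Summits.Ventures.PercRepro2.HubRootLaw
import Summits.Ventures.PercRepro2.HubConn
import Summits.Ventures.PercRepro2.HubBernstein
import Summits.Ventures.PercRepro2.HubGc
import Summits.Ventures.PercRepro2.HubKron
import Summits.Ventures.PercRepro2.HubKernelP1
import Summits.Ventures.PercRepro2.HubTyped
import Summits.Ventures.PercRepro2.HubTypedSwap

/-!
# The root count depends only on the profile
(blind cell PercRepro2, typer-1 g8; the typed R theorem, part T1b)

The root count `rho` is invariant under exchanging two copies on one bundle (`HubTypedSwap.lean`: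
`rho_swap12`, `rho_swap23`), and since any two state triples with the same profile are connected by such
exchanges coordinate by coordinate (`rho_eq_of_prof_eq`), `rho` is a function `gamma` of the
profile `k = w¹ + w² + w³` (`rho_eq_gamma`).  Therefore

`typedCount F z τ K₃ = Σ_k gamma k · Σ_π Ninner π · W^{K₃}_k(π)` (`typedCount_eq_gamma_Wtot`).
-/

namespace Summit.Ventures.PercRepro2.Hub

open Classical

section Profile

/-- The bits of a state triple at a bundle. -/
def bitsAt (w : WTriple) (j : Fin 7) : Bool × Bool × Bool := (w.1 j, w.2.1 j, w.2.2 j)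

/-- The sum of three bits. -/
def bitSum (b : Bool × Bool × Bool) : ℕ := b.1.toNat + b.2.1.toNat + b.2.2.toNat

/-- Exchange the first two bits. -/
def s12 (b : Bool × Bool × Bool) : Bool × Bool × Bool := (b.2.1, b.1, b.2.2)

/-- Exchange the last two bits. -/
def s23 (b : Bool × Bool × Bool) : Bool × Bool × Bool := (b.1, b.2.2, b.2.1)

/-- Two bit triples with the same sum are connected by at most three exchanges. -/
lemma reach_of_bitSum_eq (b b' : Bool × Bool × Bool) (h : bitSum b = bitSum b') :
    b' = b ∨ b' = s12 b ∨ b' = s23 b ∨ b' = s12 (s23 b) ∨ b' = s23 (s12 b) ∨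
      b' = s12 (s23 (s12 b)) := by
  revert b b' h
  decide

/-- The bits of `swapW12 i w` at `i`. -/
lemma bitsAt_swapW12_self (i : Fin 7) (w : WTriple) : bitsAt (swapW12 i w) i = s12 (bitsAt w i) := by
  simp [bitsAt, swapW12, s12]

/-- The bits of `swapW23 i w` at `i`. -/
lemma bitsAt_swapW23_self (i : Fin 7) (w : WTriple) : bitsAt (swapW23 i w) i = s23 (bitsAt w i) := by
  simp [bitsAt, swapW23, s23]

/-- The bits of `swapW12 i w` elsewhere. -/
lemma bitsAt_swapW12_ne {i j : Fin 7} (hij : j ≠ i) (w : WTriple) :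
    bitsAt (swapW12 i w) j = bitsAt w j := by
  simp [bitsAt, swapW12, Function.update_of_ne hij]

/-- The bits of `swapW23 i w` elsewhere. -/
lemma bitsAt_swapW23_ne {i j : Fin 7} (hij : j ≠ i) (w : WTriple) :
    bitsAt (swapW23 i w) j = bitsAt w j := by
  simp [bitsAt, swapW23, Function.update_of_ne hij]

/-- State triples with the same bits everywhere are equal. -/
lemma WTriple.ext_bits {w w' : WTriple} (h : ∀ j, bitsAt w j = bitsAt w' j) : w = w' := by
  obtain ⟨w1, w2, w3⟩ := w
  obtain ⟨w1', w2', w3'⟩ := w'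
  simp only [bitsAt, Prod.mk.injEq] at h
  simp only [Prod.mk.injEq]
  exact ⟨funext fun j => (h j).1, funext fun j => (h j).2.1, funext fun j => (h j).2.2⟩

/-- The profile is the bit sum at every bundle. -/
lemma prof_eq_bitSum (w : WTriple) (j : Fin 7) :
    (prof w.1 w.2.1 w.2.2 j : ℕ) = bitSum (bitsAt w j) := rfl

variable {V : Type*} {E : Type*} [Fintype E] [DecidableEq E] [DecidableEq V]
  {ends : E → Sym2 V} {μ : Mark → V}

/-- Applying the exchanges at bundle `i` that realise a given bit triple. -/
lemma rho_eq_of_bits (hinj : Function.Injective μ) (F : Finset E) (z : Config E) (τ : E → ℕ)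
    (i : Fin 7) (w : WTriple) (b' : Bool × Bool × Bool) (hb : bitSum (bitsAt w i) = bitSum b') :
    ∃ w' : WTriple, rho ends μ F z τ w' = rho ends μ F z τ w ∧ bitsAt w' i = b' ∧
      ∀ j, j ≠ i → bitsAt w' j = bitsAt w j := by
  rcases reach_of_bitSum_eq _ _ hb with h | h | h | h | h | h
  · exact ⟨w, rfl, h.symm, fun _ _ => rfl⟩
  · exact ⟨swapW12 i w, rho_swap12 hinj F z τ i w, by rw [bitsAt_swapW12_self, h],
      fun j hj => bitsAt_swapW12_ne hj w⟩
  · exact ⟨swapW23 i w, rho_swap23 hinj F z τ i w, by rw [bitsAt_swapW23_self, h],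
      fun j hj => bitsAt_swapW23_ne hj w⟩
  · refine ⟨swapW12 i (swapW23 i w), ?_, ?_, fun j hj => ?_⟩
    · rw [rho_swap12 hinj, rho_swap23 hinj]
    · rw [bitsAt_swapW12_self, bitsAt_swapW23_self, h]
    · rw [bitsAt_swapW12_ne hj, bitsAt_swapW23_ne hj]
  · refine ⟨swapW23 i (swapW12 i w), ?_, ?_, fun j hj => ?_⟩
    · rw [rho_swap23 hinj, rho_swap12 hinj]
    · rw [bitsAt_swapW23_self, bitsAt_swapW12_self, h]
    · rw [bitsAt_swapW23_ne hj, bitsAt_swapW12_ne hj]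
  · refine ⟨swapW12 i (swapW23 i (swapW12 i w)), ?_, ?_, fun j hj => ?_⟩
    · rw [rho_swap12 hinj, rho_swap23 hinj, rho_swap12 hinj]
    · rw [bitsAt_swapW12_self, bitsAt_swapW23_self, bitsAt_swapW12_self, h]
    · rw [bitsAt_swapW12_ne hj, bitsAt_swapW23_ne hj, bitsAt_swapW12_ne hj]

/-- The induction: agreement on the bundles `≥ n` plus equal bit sums gives equal root counts. -/
lemma rho_eq_of_agree (hinj : Function.Injective μ) (F : Finset E) (z : Config E) (τ : E → ℕ) :
    ∀ (n : ℕ) (w w' : WTriple), (∀ j : Fin 7, n ≤ j.val → bitsAt w j = bitsAt w' j) →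
      (∀ j, bitSum (bitsAt w j) = bitSum (bitsAt w' j)) → rho ends μ F z τ w = rho ends μ F z τ w' := by
  intro n
  induction n with
  | zero =>
    intro w w' hagree _
    rw [WTriple.ext_bits fun j => hagree j (Nat.zero_le _)]
  | succ n ih =>
    intro w w' hagree hsum
    by_cases hn : n < 7
    · obtain ⟨w'', hrho, hbits, hother⟩ :=
        rho_eq_of_bits hinj F z τ ⟨n, hn⟩ w (bitsAt w' ⟨n, hn⟩) (hsum ⟨n, hn⟩)
      rw [← hrho]
      refine ih w'' w' (fun j hj => ?_) fun j => ?_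
      · by_cases hji : j = ⟨n, hn⟩
        · rw [hji, hbits]
        · rw [hother j hji]
          exact hagree j (by
            have : n ≠ j.val := fun h => hji (Fin.ext h.symm)
            omega)
      · by_cases hji : j = ⟨n, hn⟩
        · rw [hji, hbits]
        · rw [hother j hji]
          exact hsum j
    · exact ih w w' (fun j hj => hagree j (by have := j.isLt; omega)) hsum

/-- **The root count depends only on the profile.** -/
theorem rho_eq_of_prof_eq (hinj : Function.Injective μ) (F : Finset E) (z : Config E) (τ : E → ℕ)
    {w w' : WTriple} (h : prof w.1 w.2.1 w.2.2 = prof w'.1 w'.2.1 w'.2.2) :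
    rho ends μ F z τ w = rho ends μ F z τ w' :=
  rho_eq_of_agree hinj F z τ 7 w w' (fun j hj => absurd hj (by have := j.isLt; omega)) fun j => by
    rw [← prof_eq_bitSum, ← prof_eq_bitSum, h]

/-- The canonical state triple of a profile: the first `kᵢ` copies open. -/
def wcanon (k : Fin 7 → Fin 4) : WTriple :=
  (fun j => decide (1 ≤ (k j : ℕ)), fun j => decide (2 ≤ (k j : ℕ)), fun j => decide (3 ≤ (k j : ℕ)))

/-- The profile of the canonical triple. -/
lemma prof_wcanon (k : Fin 7 → Fin 4) : prof (wcanon k).1 (wcanon k).2.1 (wcanon k).2.2 = k := by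
  funext j
  apply Fin.ext
  rw [prof_apply]
  have hlt := (k j).isLt
  simp only [wcanon]
  generalize (k j : ℕ) = v at hlt ⊢
  interval_cases v <;> decide

/-- **The root count as a function of the profile**: `gamma`. -/
noncomputable def gamma (ends : E → Sym2 V) (μ : Mark → V) (F : Finset E) (z : Config E)
    (τ : E → ℕ) (k : Fin 7 → Fin 4) : ℕ :=
  rho ends μ F z τ (wcanon k)

/-- `rho = gamma ∘ prof`. -/
theorem rho_eq_gamma (hinj : Function.Injective μ) (F : Finset E) (z : Config E) (τ : E → ℕ)
    (w : WTriple) : rho ends μ F z τ w = gamma ends μ F z τ (prof w.1 w.2.1 w.2.2) := by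
  unfold gamma
  exact rho_eq_of_prof_eq hinj F z τ (by rw [prof_wcanon])

end Profile

section Decomposition

variable {V : Type*} {E : Type*} [Fintype E] [DecidableEq E] [DecidableEq V]
  {S : Type*} [Field S] [LinearOrder S] [IsStrictOrderedRing S]

set_option maxRecDepth 16000 in
/-- **THE TYPED HUB DECOMPOSITION**: on the class R, the typed count of `K₃` is a nonnegative
combination over the profiles `k` of the pairings of the hub table `W^{K₃}_k` with the inner count
tensor. -/
theorem typedCount_eq_gamma_Wtot (ends : E → Sym2 V) (o a₁ a₂ a₃ b : V)
    (hinj : Function.Injective (markOf o a₁ a₂ a₃ b)) (hR : ClassR ends (markOf o a₁ a₂ a₃ b))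
    (F : Finset E) (z : Config E) (τ : E → ℕ) :
    typedCount F z τ (CovForm.K3 ends o a₁ a₂ a₃ b : Config E → Config E → Config E → S) =
      ∑ k : Fin 7 → Fin 4, (gamma ends (markOf o a₁ a₂ a₃ b) F z τ k : S) *
        ∑ π : PTriple, (Ninner ends (markOf o a₁ a₂ a₃ b) F z τ π : S) *
          (WtotK3 k π.1 π.2.1 π.2.2 : S) := by
  rw [typedCount_eq_rho_Ninner ends o a₁ a₂ a₃ b hinj hR F z τ]
  simp only [rho_eq_gamma hinj]
  symm
  calc ∑ k : Fin 7 → Fin 4, (gamma ends (markOf o a₁ a₂ a₃ b) F z τ k : S) *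
        ∑ π : PTriple, (Ninner ends (markOf o a₁ a₂ a₃ b) F z τ π : S) *
          (WtotK3 k π.1 π.2.1 π.2.2 : S)
      = ∑ k : Fin 7 → Fin 4, ∑ w ∈ Finset.univ.filter (fun w : WTriple => prof w.1 w.2.1 w.2.2 = k),
          ∑ π : PTriple, (gamma ends (markOf o a₁ a₂ a₃ b) F z τ (prof w.1 w.2.1 w.2.2) : S) *
            ((Ninner ends (markOf o a₁ a₂ a₃ b) F z τ π : S) *
              (K3Z w.1 π.1 w.2.1 π.2.1 w.2.2 π.2.2 : S)) := by
        refine Finset.sum_congr rfl fun k _ => ?_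
        simp only [WtotK3_eq, Int.cast_sum, Finset.mul_sum]
        rw [Finset.sum_comm]
        refine Finset.sum_congr rfl fun w hw => Finset.sum_congr rfl fun π _ => ?_
        rw [(Finset.mem_filter.1 hw).2]
    _ = ∑ w : WTriple, ∑ π : PTriple,
          (gamma ends (markOf o a₁ a₂ a₃ b) F z τ (prof w.1 w.2.1 w.2.2) : S) *
            ((Ninner ends (markOf o a₁ a₂ a₃ b) F z τ π : S) *
              (K3Z w.1 π.1 w.2.1 π.2.1 w.2.2 π.2.2 : S)) :=
        Finset.sum_fiberwise Finset.univ (fun w : WTriple => prof w.1 w.2.1 w.2.2) _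

end Decomposition

end Summit.Ventures.PercRepro2.Hub
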